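import Literature.AlgebraicGeometry.Motives.MumfordTateInvariantsHodgeBasis
import HarnessLib

/-!
# Hodge tensors of type `(p,p)` in a graded tensor basis; the infinitesimal Hodge operator `Θ` and the Weil operator `C` (Zarhin's theorem, step 2)

For a pure `ℚ`-Hodge structure `H` of weight `n` on a finite-dimensional `V`, a GRADED BASIS
`e` of `V_ℂ` (`F^a = span {e σ | a ≤ deg σ}`, `conj F^a = span {e σ | deg σ ≤ n - a}`, as produced
by `exists_basis_F_eq_span` / `Polarization.exists_orthonormal_graded_basis`) and a rational
Hodge class `t ∈ T^{a,b} V` of type `(p,p)` (`(a - b) n = 2p`, the tensors fixed by the tree's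
`HodgeStructure.hodgeGroup`), we prove:

* `piece_eq_span_of_graded`: `V^{p,n-p} = span {e σ | deg σ = p}`;
* `tensorSpaceToBaseChange_mem_span_degree_eq`: the complexification `ι t` lies in the span of
  the tensor basis vectors `hodgeTensorBasis e a b x` of total degree `tensorDegree deg x = p`
  (Deligne, *Hodge II*, 1.1.12; the case `p = 0` is the other seat's
  `tensorSpaceToBaseChange_mem_span_degree_zero`);
* `tensorDerivation_apply_eq_zero_of_graded_diag`: an endomorphism `Y` of `V_ℂ` diagonal in `e`
  with eigenvalues `c · (2 deg σ - n)` (i.e. acting on `V^{p,q}` by `c (p - q)`) KILLS `ι t` under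
  the derivation action — the case `c = 1` is the **infinitesimal Hodge operator** `Θ`, the
  differential of `h|𝕌 : U(1) → GL(V_ℝ)`, and this is the infinitesimal form of "the Hodge
  tensors are fixed by `h(U(1))`" (Deligne, LNM 900, I 3.4; Huybrechts, *Lectures on K3
  Surfaces*, §3.3.4, p. 66);
* `tensorSpaceActOver_eq_self_of_graded_diag`: an automorphism `k` of `V_ℂ` diagonal in `e` with
  eigenvalues `ζ ^ (2 deg σ - n)`, `ζ ≠ 0` (e.g. the **Weil operator** `C = h(i)`, `ζ = i`), FIXES
  `ι t`;
* existence and intrinsic description of such operators: `exists_hodgeTheta`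
  (`Θ x = (p - q) x` on `V^{p,q}`), `exists_weilOperator` (`C x = i^{p-q} x` on `V^{p,q}`), and
  the fact that an operator given intrinsically on the pieces is diagonal in EVERY graded basis
  (`apply_basis_eq_of_forall_piece`).

All statements are theorem-only (no definitions, no named facts); `Θ` and `C` are carried
around downstream as operators satisfying their defining property on the Hodge pieces.

## References

* P. Deligne, *Théorie de Hodge II*, Publ. Math. IHÉS 40 (1971), 1.1.12, 1.2.5.
* P. Deligne, *Hodge cycles on abelian varieties*, LNM 900 (1982), I §3, Prop. 3.4.
* D. Huybrechts, *Lectures on K3 Surfaces* (CUP 2016), §3.3.4 (p. 66), Thm. 3.3.9.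
-/

noncomputable section

open scoped TensorProduct PiTensorProduct

namespace Literature.AlgebraicGeometry.Motives

namespace HodgeStructure

universe u

variable {V : Type u} [AddCommGroup V] [Module ℚ V] [Module.Finite ℚ V] {n : ℤ}
  {S : Type u} [Fintype S] [DecidableEq S] {deg : S → ℤ}

/-! ### Hodge pieces in a graded basis -/

omit [Module.Finite ℚ V] [Fintype S] [DecidableEq S] in
/-- In a graded basis, the Hodge piece `V^{p,n-p} = F^p ∩ conj F^{n-p}` is the span of the basis
vectors of degree `p` (Deligne, *Hodge II*, 1.2.5). [cite: DeligneHodgeII1971, 1.2.5] -/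
theorem piece_eq_span_of_graded (H : HodgeStructure V n) (e : Module.Basis S ℂ (ℂ ⊗[ℚ] V))
    (hF : ∀ a, H.F a = Submodule.span ℂ (e '' {σ | a ≤ deg σ}))
    (hFc : ∀ a, complexConj (H.F a) = Submodule.span ℂ (e '' {σ | deg σ ≤ n - a})) (p : ℤ) :
    H.piece p (n - p) = Submodule.span ℂ (e '' {σ | deg σ = p}) := by
  rw [piece_of_add_eq H (by ring), hF, hFc, span_basis_image_inf]
  congr 2
  ext σ
  simp only [Set.mem_inter_iff, Set.mem_setOf_eq]
  omega

omit [Module.Finite ℚ V] [Fintype S] [DecidableEq S] in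
/-- In a graded basis, `e σ ∈ V^{deg σ, n - deg σ}`. [folklore] -/
theorem basis_mem_piece_of_graded (H : HodgeStructure V n) (e : Module.Basis S ℂ (ℂ ⊗[ℚ] V))
    (hF : ∀ a, H.F a = Submodule.span ℂ (e '' {σ | a ≤ deg σ}))
    (hFc : ∀ a, complexConj (H.F a) = Submodule.span ℂ (e '' {σ | deg σ ≤ n - a})) (σ : S) :
    e σ ∈ H.piece (deg σ) (n - deg σ) := by
  rw [piece_eq_span_of_graded H e hF hFc]
  exact Submodule.subset_span ⟨σ, rfl, rfl⟩

omit [Module.Finite ℚ V] [Fintype S] [DecidableEq S] in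
/-- **An operator given on the Hodge pieces is diagonal in every graded basis**: if
`Y x = f p • x` for `x ∈ V^{p,n-p}` then `Y (e σ) = f (deg σ) • e σ`. [folklore] -/
theorem apply_basis_eq_of_forall_piece (H : HodgeStructure V n) (e : Module.Basis S ℂ (ℂ ⊗[ℚ] V))
    (hF : ∀ a, H.F a = Submodule.span ℂ (e '' {σ | a ≤ deg σ}))
    (hFc : ∀ a, complexConj (H.F a) = Submodule.span ℂ (e '' {σ | deg σ ≤ n - a}))
    {Y : ℂ ⊗[ℚ] V → ℂ ⊗[ℚ] V} {f : ℤ → ℂ} (hY : ∀ p, ∀ x ∈ H.piece p (n - p), Y x = f p • x)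
    (σ : S) : Y (e σ) = f (deg σ) • e σ :=
  hY (deg σ) (e σ) (basis_mem_piece_of_graded H e hF hFc σ)

omit [Module.Finite ℚ V] [Fintype S] [DecidableEq S] in
/-- Conversely, **an operator diagonal in a graded basis with eigenvalue depending only on the
degree acts on `V^{p,n-p}` by that eigenvalue.** [folklore] -/
theorem apply_eq_smul_of_mem_piece_of_graded (H : HodgeStructure V n)
    (e : Module.Basis S ℂ (ℂ ⊗[ℚ] V))
    (hF : ∀ a, H.F a = Submodule.span ℂ (e '' {σ | a ≤ deg σ}))
    (hFc : ∀ a, complexConj (H.F a) = Submodule.span ℂ (e '' {σ | deg σ ≤ n - a}))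
    (Y : Module.End ℂ (ℂ ⊗[ℚ] V)) {f : ℤ → ℂ} (hY : ∀ σ, Y (e σ) = f (deg σ) • e σ)
    (p : ℤ) {x : ℂ ⊗[ℚ] V} (hx : x ∈ H.piece p (n - p)) : Y x = f p • x := by
  rw [piece_eq_span_of_graded H e hF hFc] at hx
  induction hx using Submodule.span_induction with
  | mem y hy =>
    obtain ⟨σ, hσ, rfl⟩ := hy
    rw [hY σ, show deg σ = p from hσ]
  | zero => simp
  | add y z _ _ hy hz => rw [map_add, hy, hz, smul_add]
  | smul c y _ hy => rw [map_smul, hy, smul_comm]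

/-! ### Existence of the infinitesimal Hodge operator `Θ` and of the Weil operator `C` -/

omit [Module.Finite ℚ V] [Fintype S] [DecidableEq S] in
/-- **The infinitesimal Hodge operator `Θ`** exists: a `ℂ`-linear endomorphism of `V_ℂ` acting on
`V^{p,q}` by `p - q = 2p - n` (the differential at `1` of `h|𝕌 : U(1) → GL(V_ℝ)`, `z ↦ z^p z̄^q`
on `V^{p,q}`; Huybrechts, §3.3.4; Deligne, LNM 900, I 3.4). Constructed as the diagonal operator
in a graded basis (`exists_basis_F_eq_span`). [cite: Huybrechts2016K3, §3.3.4 (p. 66)] -/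
theorem exists_hodgeTheta [HodgeTensorFacts.{u, u}] (H : HodgeStructure V n) :
    ∃ Θ : Module.End ℂ (ℂ ⊗[ℚ] V),
      ∀ p, ∀ x ∈ H.piece p (n - p), Θ x = ((2 * p - n : ℤ) : ℂ) • x := by
  classical
  obtain ⟨S, deg, e, hF, hFc⟩ := exists_basis_F_eq_span H
  refine ⟨e.constr ℂ fun σ => ((2 * deg σ - n : ℤ) : ℂ) • e σ, fun p x hx => ?_⟩
  exact apply_eq_smul_of_mem_piece_of_graded H e hF hFc _ (f := fun d => ((2 * d - n : ℤ) : ℂ))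
    (fun σ => by simp [Module.Basis.constr_basis]) p hx

omit [Module.Finite ℚ V] [Fintype S] [DecidableEq S] in
/-- **The Weil operator `C`** exists: a `ℂ`-linear automorphism of `V_ℂ` acting on `V^{p,q}` by
`i^{p-q} = i^{2p-n}` (`C = h(i)`; Deligne, *Hodge II*, 2.1.15; Voisin, *Hodge Theory I*, §7.1.2),
together with its inverse acting by `i^{-(2p-n)}`. [folklore] -/
theorem exists_weilOperator [HodgeTensorFacts.{u, u}] (H : HodgeStructure V n) :
    ∃ C : (ℂ ⊗[ℚ] V) ≃ₗ[ℂ] (ℂ ⊗[ℚ] V),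
      (∀ p, ∀ x ∈ H.piece p (n - p), C x = (Complex.I ^ (2 * p - n)) • x) ∧
      ∀ p, ∀ x ∈ H.piece p (n - p), C.symm x = (Complex.I ^ (2 * p - n))⁻¹ • x := by
  classical
  obtain ⟨S, deg, e, hF, hFc⟩ := exists_basis_F_eq_span H
  have hne : ∀ d : ℤ, (Complex.I ^ (2 * d - n)) ≠ 0 := fun d => zpow_ne_zero _ Complex.I_ne_zero
  let w : S → ℂˣ := fun σ => Units.mk0 _ (hne (deg σ))
  let C : (ℂ ⊗[ℚ] V) ≃ₗ[ℂ] (ℂ ⊗[ℚ] V) := e.equiv (e.unitsSMul w) (Equiv.refl S)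
  have hC : ∀ σ, C (e σ) = (Complex.I ^ (2 * deg σ - n)) • e σ := fun σ => by
    simp [C, w, Module.Basis.equiv_apply, Module.Basis.unitsSMul_apply]
  have hC' : ∀ σ, C.symm (e σ) = (Complex.I ^ (2 * deg σ - n))⁻¹ • e σ := fun σ => by
    apply C.injective
    rw [LinearEquiv.apply_symm_apply, map_smul, hC, smul_smul, inv_mul_cancel₀ (hne _), one_smul]
  exact ⟨C,
    fun p x hx => apply_eq_smul_of_mem_piece_of_graded H e hF hFc C.toLinearMap
      (f := fun d => Complex.I ^ (2 * d - n)) hC p hx,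
    fun p x hx => apply_eq_smul_of_mem_piece_of_graded H e hF hFc C.symm.toLinearMap
      (f := fun d => (Complex.I ^ (2 * d - n))⁻¹) hC' p hx⟩

/-! ### Hodge classes of type `(p,p)` in the graded tensor basis -/

variable [HodgeTensorFacts.{u, u}]

/-- **A Hodge class of type `(p,p)` complexifies into the degree-`p` part of the tensor basis**:
for `t ∈ T^{a,b} V` rational with `1 ⊗ t ∈ F^p`, `(a - b) n = 2p`:
`1 ⊗ t ∈ F^p ∩ conj F^p = span {E x | tensorDegree x = p}` (Deligne, *Hodge II*, 1.1.12 and 1.2.5;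
the case `p = 0` is `one_tmul_mem_span_degree_zero`). [cite: DeligneHodgeII1971, 1.1.12 and 1.2.5] -/
theorem one_tmul_mem_span_degree_eq (H : HodgeStructure V n) (e : Module.Basis S ℂ (ℂ ⊗[ℚ] V))
    (hF : ∀ a, H.F a = Submodule.span ℂ (e '' {σ | a ≤ deg σ}))
    (hFc : ∀ a, complexConj (H.F a) = Submodule.span ℂ (e '' {σ | deg σ ≤ n - a})) {a b : ℕ}
    {p : ℤ} (hab : ((a : ℤ) - b) * n = 2 * p) {t : hodgeTensorSpace V a b}
    (ht : t ∈ (H.tensorSpace a b).hodgeClasses p) :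
    (1 : ℂ) ⊗ₜ[ℚ] t ∈
      Submodule.span ℂ (hodgeTensorBasisBC e a b '' {x | tensorDegree deg x = p}) := by
  have h1 : (1 : ℂ) ⊗ₜ[ℚ] t ∈ (H.tensorSpace a b).F p := ht
  have h2 : (1 : ℂ) ⊗ₜ[ℚ] t ∈ complexConj ((H.tensorSpace a b).F p) := by
    rw [mem_complexConj, conj_tmul, map_one]
    exact h1
  rw [tensorSpace_F_eq_span H e hF] at h1
  rw [complexConj_tensorSpace_F_eq_span H e hFc, hab] at h2
  have h := Submodule.mem_inf.2 ⟨h1, h2⟩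
  rw [span_basis_image_inf] at h
  have hset : ({x | p ≤ tensorDegree deg x} ∩ {x | tensorDegree deg x ≤ 2 * p - p} :
      Set ((Fin a → S) × (Fin b → S))) = {x | tensorDegree deg x = p} := by
    ext x
    simp only [Set.mem_setOf_eq, Set.mem_inter_iff]
    omega
  rwa [hset] at h

/-- Transported version: the complexification `ι t = tensorSpaceToBaseChange ℂ V a b t` of a
Hodge class of type `(p,p)` lies in the span of the tensor basis vectors `hodgeTensorBasis e a b x`
of total degree `p`. [cite: DeligneHodgeII1971, 1.1.12 and 1.2.5] -/
theorem tensorSpaceToBaseChange_mem_span_degree_eq (H : HodgeStructure V n)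
    (e : Module.Basis S ℂ (ℂ ⊗[ℚ] V))
    (hF : ∀ a, H.F a = Submodule.span ℂ (e '' {σ | a ≤ deg σ}))
    (hFc : ∀ a, complexConj (H.F a) = Submodule.span ℂ (e '' {σ | deg σ ≤ n - a})) {a b : ℕ}
    {p : ℤ} (hab : ((a : ℤ) - b) * n = 2 * p) {t : hodgeTensorSpace V a b}
    (ht : t ∈ (H.tensorSpace a b).hodgeClasses p) :
    tensorSpaceToBaseChange ℂ V a b t ∈
      Submodule.span ℂ (hodgeTensorBasis e a b '' {x | tensorDegree deg x = p}) := by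
  rw [← hodgeTensorSpaceBaseChange_one_tmul]
  have h := Submodule.mem_map_of_mem (f := (hodgeTensorSpaceBaseChange V a b).toLinearMap)
    (one_tmul_mem_span_degree_eq H e hF hFc hab ht)
  rw [Submodule.map_span, ← Set.image_comp] at h
  have hfun : (⇑(hodgeTensorSpaceBaseChange V a b).toLinearMap ∘ ⇑(hodgeTensorBasisBC e a b)) =
      ⇑(hodgeTensorBasis e a b) :=
    funext fun x => hodgeTensorSpaceBaseChange_hodgeTensorBasisBC e a b x
  rw [hfun] at h
  exact h

/-! ### `Θ` kills, and `C` fixes, the complexified Hodge tensors -/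

/-- **A graded-diagonal derivation with eigenvalues `c (2 deg σ - n)` kills the complexified
Hodge classes of type `(p,p)`.** On the tensor basis vector indexed by `x` such a `Y` acts by
`c (2 · tensorDegree x - (a - b) n)`, which vanishes in degree `p` when `(a - b) n = 2p`. For
`c = 1` this is `Θ · ι t = 0`: the Hodge tensors are annihilated by the Lie algebra of `h(U(1))`
(Deligne, LNM 900, I 3.4, infinitesimally). [cite: Deligne1982HodgeCycles, I proof of Prop. 3.4] -/
theorem tensorDerivation_apply_eq_zero_of_graded_diag (H : HodgeStructure V n)
    (e : Module.Basis S ℂ (ℂ ⊗[ℚ] V))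
    (hF : ∀ a, H.F a = Submodule.span ℂ (e '' {σ | a ≤ deg σ}))
    (hFc : ∀ a, complexConj (H.F a) = Submodule.span ℂ (e '' {σ | deg σ ≤ n - a}))
    {Y : Module.End ℂ (ℂ ⊗[ℚ] V)} {c : ℂ} (hY : ∀ σ, Y (e σ) = (c * ((2 * deg σ - n : ℤ) : ℂ)) • e σ)
    {a b : ℕ} {p : ℤ} (hab : ((a : ℤ) - b) * n = 2 * p) {t : hodgeTensorSpace V a b}
    (ht : t ∈ (H.tensorSpace a b).hodgeClasses p) :
    tensorDerivation a b Y (tensorSpaceToBaseChange ℂ V a b t) = 0 := by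
  have hmem := tensorSpaceToBaseChange_mem_span_degree_eq H e hF hFc hab ht
  have hle : Submodule.span ℂ (hodgeTensorBasis e a b '' {x | tensorDegree deg x = p}) ≤
      LinearMap.ker (tensorDerivation a b Y) := by
    rw [Submodule.span_le]
    rintro _ ⟨x, hx, rfl⟩
    rw [SetLike.mem_coe, LinearMap.mem_ker, tensorDerivation_hodgeTensorBasis' e hY x]
    have hdeg : tensorDegree deg x = p := hx
    have hsum : ((∑ i, c * ((2 * deg (x.1 i) - n : ℤ) : ℂ)) -
        ∑ j, c * ((2 * deg (x.2 j) - n : ℤ) : ℂ)) =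
        c * ((2 * tensorDegree deg x - ((a : ℤ) - b) * n : ℤ) : ℂ) := by
      rw [← Finset.mul_sum, ← Finset.mul_sum, ← mul_sub, tensorDegree_apply]
      push_cast
      simp only [Finset.sum_sub_distrib, Finset.sum_const, Finset.card_univ, Fintype.card_fin,
        nsmul_eq_mul, ← Finset.mul_sum]
      ring
    rw [hsum, hdeg, hab, sub_self]
    simp
  exact hle hmem

/-- **A graded-diagonal automorphism with eigenvalues `ζ ^ (2 deg σ - n)` fixes the complexified
Hodge classes of type `(p,p)`** (`ζ ≠ 0`): on the tensor basis vector indexed by `x` it acts by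
`ζ ^ (2 · tensorDegree x - (a - b) n) = ζ⁰`. For `ζ = i` this is the Weil operator `C = h(i)`; for
`|ζ| = 1` it is `h(ζ)`, `ζ ∈ U(1)` ("the Hodge tensors are fixed by `h(U(1))`", Deligne, LNM 900,
I 3.4; Huybrechts p. 66). [cite: Deligne1982HodgeCycles, I proof of Prop. 3.4] -/
theorem tensorSpaceActOver_eq_self_of_graded_diag (H : HodgeStructure V n)
    (e : Module.Basis S ℂ (ℂ ⊗[ℚ] V))
    (hF : ∀ a, H.F a = Submodule.span ℂ (e '' {σ | a ≤ deg σ}))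
    (hFc : ∀ a, complexConj (H.F a) = Submodule.span ℂ (e '' {σ | deg σ ≤ n - a}))
    {k : (ℂ ⊗[ℚ] V) ≃ₗ[ℂ] (ℂ ⊗[ℚ] V)} {ζ : ℂ} (hζ : ζ ≠ 0)
    (hk : ∀ σ, k (e σ) = (ζ ^ (2 * deg σ - n)) • e σ)
    {a b : ℕ} {p : ℤ} (hab : ((a : ℤ) - b) * n = 2 * p) {t : hodgeTensorSpace V a b}
    (ht : t ∈ (H.tensorSpace a b).hodgeClasses p) :
    tensorSpaceActOver k (tensorSpaceToBaseChange ℂ V a b t) = tensorSpaceToBaseChange ℂ V a b t := by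
  have hmem := tensorSpaceToBaseChange_mem_span_degree_eq H e hF hFc hab ht
  refine Submodule.span_induction (p := fun s _ => tensorSpaceActOver k s = s) ?_ ?_ ?_ ?_ hmem
  · rintro _ ⟨x, hx, rfl⟩
    rw [tensorSpaceActOver_hodgeTensorBasis e hk x.1 x.2]
    have hdeg : tensorDegree deg x = p := hx
    have hzs : ∀ (m : ℕ) (f : Fin m → ℤ), ∏ i, ζ ^ f i = ζ ^ ∑ i, f i := fun m f => by
      induction (Finset.univ : Finset (Fin m)) using Finset.induction_on with
      | empty => simp
      | insert i s hi ih => rw [Finset.prod_insert hi, Finset.sum_insert hi, ih, zpow_add₀ hζ]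
    have hprod : (∏ i, ζ ^ (2 * deg (x.1 i) - n)) * (∏ j, ζ ^ (2 * deg (x.2 j) - n))⁻¹ =
        ζ ^ (2 * tensorDegree deg x - ((a : ℤ) - b) * n) := by
      rw [hzs a (fun i => 2 * deg (x.1 i) - n), hzs b (fun j => 2 * deg (x.2 j) - n), ← zpow_neg,
        ← zpow_add₀ hζ, tensorDegree_apply]
      congr 1
      simp only [Finset.sum_sub_distrib, Finset.sum_const, Finset.card_univ, Fintype.card_fin,
        ← Finset.mul_sum]
      ring
    rw [hprod, hdeg, hab, sub_self, zpow_zero, one_smul]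
  · simp
  · intro x y _ _ hx hy
    rw [map_add, hx, hy]
  · intro c x _ hx
    rw [map_smul, hx]

/-- **`Θ` kills the complexified Hodge tensors**: for any `Θ` acting on `V^{p,n-p}` by `2p - n`
and any Hodge class `t` of type `(p,p)` in `T^{a,b}`, `ρ(Θ) (ι t) = 0`.
[cite: Deligne1982HodgeCycles, I proof of Prop. 3.4] -/
theorem tensorDerivation_hodgeTheta_apply_eq_zero (H : HodgeStructure V n)
    {Θ : Module.End ℂ (ℂ ⊗[ℚ] V)}
    (hΘ : ∀ p, ∀ x ∈ H.piece p (n - p), Θ x = ((2 * p - n : ℤ) : ℂ) • x)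
    {a b : ℕ} {p : ℤ} (hab : ((a : ℤ) - b) * n = 2 * p) {t : hodgeTensorSpace V a b}
    (ht : t ∈ (H.tensorSpace a b).hodgeClasses p) :
    tensorDerivation a b Θ (tensorSpaceToBaseChange ℂ V a b t) = 0 := by
  classical
  obtain ⟨S, deg, e, hF, hFc⟩ := exists_basis_F_eq_span H
  haveI : Fintype S := FiniteDimensional.fintypeBasisIndex e
  refine tensorDerivation_apply_eq_zero_of_graded_diag H e hF hFc (c := 1) (fun σ => ?_) hab ht
  rw [one_mul]
  exact apply_basis_eq_of_forall_piece H e hF hFc (f := fun d => ((2 * d - n : ℤ) : ℂ)) hΘ σ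

/-- **The Weil operator fixes the complexified Hodge tensors**: for any automorphism `C` acting on
`V^{p,n-p}` by `i^{2p-n}` and any Hodge class `t` of type `(p,p)`, `C · ι t = ι t`.
[cite: Deligne1982HodgeCycles, I proof of Prop. 3.4] -/
theorem tensorSpaceActOver_weilOperator_eq_self (H : HodgeStructure V n)
    {C : (ℂ ⊗[ℚ] V) ≃ₗ[ℂ] (ℂ ⊗[ℚ] V)}
    (hC : ∀ p, ∀ x ∈ H.piece p (n - p), C x = (Complex.I ^ (2 * p - n)) • x)
    {a b : ℕ} {p : ℤ} (hab : ((a : ℤ) - b) * n = 2 * p) {t : hodgeTensorSpace V a b}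
    (ht : t ∈ (H.tensorSpace a b).hodgeClasses p) :
    tensorSpaceActOver C (tensorSpaceToBaseChange ℂ V a b t) = tensorSpaceToBaseChange ℂ V a b t := by
  classical
  obtain ⟨S, deg, e, hF, hFc⟩ := exists_basis_F_eq_span H
  haveI : Fintype S := FiniteDimensional.fintypeBasisIndex e
  exact tensorSpaceActOver_eq_self_of_graded_diag H e hF hFc Complex.I_ne_zero
    (fun σ => apply_basis_eq_of_forall_piece H e hF hFc (f := fun d => Complex.I ^ (2 * d - n)) hC σ)
    hab ht

end HodgeStructure

end Literature.AlgebraicGeometry.Motives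

end
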